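/-
Copyright (c) 2026. Released under Apache 2.0 license as described in the file LICENSE.
-/
import Summits.RiemannHypothesis.RiemannHypothesis.Theorems.LiDirichletKernelClasses
import Summits.RiemannHypothesis.RiemannHypothesis.Theorems.LiKernelTable
import HarnessLib

/-!
# KERNEL LINEAGE K-χ — STRUCTURE ROWS of the Dirichlet Li table across all 37 primitive characters, `n ≤ 48`

RH-FREE DATA (finite certified ranges read off the kernel-certified table; no GRH-to-height input; 0 kit).
bears_on: LADDER-RH L-D (COLUMN 4 LI, DATA rung; Dirichlet rows — STRUCTURE of `Re λ_χ(n)` and of its arithmetic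
part `lt_χ(n) = charLiOsc χ n` across `χ`; consumers `LiCriterionDirichlet.lean:95/194/305`).
WHAT THIS IS NOT: the `∀ n` forms of these statements (positivity, monotonicity of `Re λ_χ(n)`, `|lt_χ(n)| = O(√n …)`)
are GRH-strength or open; a finite certified range is numbers, not evidence; nothing here bears on the truth of RH/GRH.

THE ENGINE is `LiDirichletKernelClasses.exists_classRows_of_isPrimitive` (every primitive character of conductor
`2 ≤ q ≤ 13` has one of the 23 tabulated row sets `classRows q`); every ROW-DECIDABLE law transfers to all 37 characters
by one `decide` over the 23 tables (`structOK`, `allStructOK_true`) — here three of them.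

THE STRUCTURE ROWS PROVED HERE (all hypothesis-free: `2 ≤ q ≤ 13`, `χ` primitive, `1 ≤ n ≤ 48`):
* `liCoeffCharRe_strictMonoOn` — `Re λ_χ(1) < Re λ_χ(2) < ⋯ < Re λ_χ(48)` (DATA.md §J.8 (S1′) in kernel form; the
  `ζ` twin is `LiKernel.keiperLiCoeff_strictMonoOn`); consecutive certified boxes are disjoint.
* `abs_charLiOsc_lt_sqrt` — the ARITHMETIC PART stays inside `(−√n, √n)`: `|lt_χ(n)| < √n` (sup over the 37 characters
  of `|lt_χ(n)|/√n` is `0.83`, at `n = 1`, `χ = 5.4`); compare the `ζ` range `0 < λ̃_n ≤ 2.04`, `n ≤ 119`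
  (`LiKernel.liOscPart_pos_le_of_le`) — for `χ` the arithmetic part takes BOTH signs already at `n ≤ 48`
  (range `[−3.61, 3.63]`).
* `keiperLiCoeff_lt_liCoeffCharRe` — THE CONDUCTOR ORDERS THE LI COEFFICIENTS: `λ_n(ζ) < Re λ_χ(n)` for every one of the
  37 characters (smallest margin `0.0335` at `n = 1`, `χ = 3.2`: `λ₁ = 0.0231 < 0.0566`); the main terms differ by
  `(n/2) log q` (`LiTheory.charLiMainTerm`), and the certified table says the ordering already holds from `n = 1`.
-/

set_option linter.dupNamespace false

namespace Summit.RiemannHypothesis.RiemannHypothesis.Theorems.LiDirichletKernel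

open Literature.NumberTheory.LFunctions Literature.NumberTheory.LFunctions.LiDirichlet
open Summit.RiemannHypothesis.RiemannHypothesis.Theorems.LiTheory
open Summit.RiemannHypothesis.RiemannHypothesis.Theorems.LiKernel

/-! ## Row-decidable structure checks and their soundness -/

/-- The structure checks on one table, row by row (`n = 1, …, 48`): `lt.hi² < n·10^{2d}` and `lt.lo² < n·10^{2d}`
(arithmetic part inside `(−√n, √n)`), `λ.hi(ζ, n)·10^{d} < λ.lo·10^{d(ζ, n)}` (the `ζ` row of `LiKernel.kTable` lies
below), and for `n < 48` `λ.hi(n)·10^{d(n+1)} < λ.lo(n+1)·10^{d(n)}` (consecutive `λ`-rows separate). -/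
def structOK (rows : RowTable) : Bool :=
  (List.range 48).all fun i ↦
    decide ((rowOf rows (i + 1)).2.2.2.2 * (rowOf rows (i + 1)).2.2.2.2 < ((i + 1 : ℕ) : ℤ) * 10 ^ (2 * (rowOf rows (i + 1)).1))
    && decide ((rowOf rows (i + 1)).2.2.2.1 * (rowOf rows (i + 1)).2.2.2.1 < ((i + 1 : ℕ) : ℤ) * 10 ^ (2 * (rowOf rows (i + 1)).1))
    && decide (lamHi (i + 1) * 10 ^ (rowOf rows (i + 1)).1 < (rowOf rows (i + 1)).2.1 * 10 ^ rowDigits (i + 1))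
    && (decide (i + 1 = 48)
      || decide ((rowOf rows (i + 1)).2.2.1 * 10 ^ (rowOf rows (i + 2)).1 < (rowOf rows (i + 2)).2.1 * 10 ^ (rowOf rows (i + 1)).1))

/-- All 23 tables pass the structure checks. -/
def allStructOK : Bool := (List.range 14).all fun q ↦ (classRows q).all structOK

/-- Kernel evaluation of the checks. -/
theorem allStructOK_true : allStructOK = true := by decide +kernel

/-- Every tabulated row set passes `structOK`. -/
theorem structOK_of_mem {q : ℕ} (hq : q ≤ 13) {rows : RowTable} (h : rows ∈ classRows q) : structOK rows = true := by
  have hall := allStructOK_true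
  unfold allStructOK at hall
  rw [List.all_eq_true] at hall
  have hq' := hall q (List.mem_range.2 (by omega))
  rw [List.all_eq_true] at hq'
  exact hq' rows h

/-- What `structOK rows = true` says at row `n`. -/
theorem structOK_spec {rows : RowTable} (h : structOK rows = true) {n : ℕ} (hn : 1 ≤ n) (hn' : n ≤ 48) :
    (rowOf rows n).2.2.2.2 * (rowOf rows n).2.2.2.2 < (n : ℤ) * 10 ^ (2 * (rowOf rows n).1) ∧
      (rowOf rows n).2.2.2.1 * (rowOf rows n).2.2.2.1 < (n : ℤ) * 10 ^ (2 * (rowOf rows n).1) ∧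
      lamHi n * 10 ^ (rowOf rows n).1 < (rowOf rows n).2.1 * 10 ^ rowDigits n ∧
      (n < 48 → (rowOf rows n).2.2.1 * 10 ^ (rowOf rows (n + 1)).1 < (rowOf rows (n + 1)).2.1 * 10 ^ (rowOf rows n).1) := by
  unfold structOK at h
  rw [List.all_eq_true] at h
  have h' := h (n - 1) (List.mem_range.2 (by omega))
  rw [show n - 1 + 1 = n by omega, show n - 1 + 2 = n + 1 by omega] at h'
  simp only [Bool.and_eq_true, Bool.or_eq_true, decide_eq_true_eq] at h'
  obtain ⟨⟨⟨h1, h2⟩, h3⟩, h4⟩ := h'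
  refine ⟨h1, h2, h3, fun hlt ↦ ?_⟩
  rcases h4 with h4 | h4
  · omega
  · exact h4

/-- Separated rows give a strict inequality. -/
theorem lt_of_rows_sep {x y : ℝ} {d d' : ℕ} {l h l' h' : ℤ} (hx : InRow x d l h) (hy : InRow y d' l' h')
    (hsep : h * 10 ^ d' < l' * 10 ^ d) : x < y := by
  have h1 : (h : ℝ) / 10 ^ d < (l' : ℝ) / 10 ^ d' := by
    rw [div_lt_div_iff₀ (by positivity) (by positivity)]
    exact_mod_cast hsep
  exact hx.2.trans_lt (h1.trans_le hy.1)

/-- A row inside `(−√n, √n)` bounds the absolute value by `√n`. -/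
theorem abs_lt_sqrt_of_row {y : ℝ} {d : ℕ} {l h : ℤ} {n : ℕ} (hy : InRow y d l h)
    (hh : h * h < (n : ℤ) * 10 ^ (2 * d)) (hl : l * l < (n : ℤ) * 10 ^ (2 * d)) : |y| < Real.sqrt n := by
  have key : ∀ z : ℤ, z * z < (n : ℤ) * 10 ^ (2 * d) → (z : ℝ) / 10 ^ d < Real.sqrt n := by
    intro z hz
    rcases le_or_gt 0 ((z : ℝ) / 10 ^ d) with hz0 | hz0
    · rw [Real.lt_sqrt hz0, div_pow, div_lt_iff₀ (by positivity), ← pow_mul, sq]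
      have : ((z * z : ℤ) : ℝ) < ((n : ℤ) * 10 ^ (2 * d) : ℤ) := by exact_mod_cast hz
      push_cast at this
      rw [mul_comm 2 d] at this
      exact this
    · exact hz0.trans_le (Real.sqrt_nonneg _)
  have hneg : ∀ z : ℤ, z * z < (n : ℤ) * 10 ^ (2 * d) → -Real.sqrt n < (z : ℝ) / 10 ^ d := by
    intro z hz
    have := key (-z) (by simpa using hz)
    push_cast at this
    rw [neg_div] at this
    linarith
  rw [abs_lt]
  exact ⟨(hneg l hl).trans_le hy.1, hy.2.trans_lt (key h hh)⟩

/-! ## The structure rows -/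

/-- **(S1′) `Re λ_χ(n)` IS STRICTLY INCREASING on `1 ≤ n ≤ 48`** for every primitive character of conductor
`2 ≤ q ≤ 13` (kernel-certified: consecutive boxes are disjoint).  RH-FREE DATA; the `∀ n` monotonicity is GRH-strength
and is NOT claimed. -/
theorem liCoeffCharRe_lt_succ {q : ℕ} [NeZero q] (hq : 2 ≤ q) (hq' : q ≤ 13) (χ : DirichletCharacter ℂ q)
    (hprim : χ.IsPrimitive) {n : ℕ} (hn : 1 ≤ n) (hn' : n + 1 ≤ 48) :
    liCoeffCharRe χ n < liCoeffCharRe χ (n + 1) := by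
  obtain ⟨rows, hmem, hrows⟩ := exists_classRows_of_isPrimitive hq hq' χ hprim
  have hs := structOK_spec (structOK_of_mem hq' hmem) hn (by omega)
  exact lt_of_rows_sep (hrows.mem n hn (by omega)).1 (hrows.mem (n + 1) (by omega) hn').1 (hs.2.2.2 (by omega))

/-- **(S1′) `Re λ_χ(1) < Re λ_χ(2) < ⋯ < Re λ_χ(48)`** (`StrictMonoOn` form; twin of `LiKernel.keiperLiCoeff_strictMonoOn`).
RH-FREE DATA. -/
theorem liCoeffCharRe_strictMonoOn {q : ℕ} [NeZero q] (hq : 2 ≤ q) (hq' : q ≤ 13) (χ : DirichletCharacter ℂ q)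
    (hprim : χ.IsPrimitive) : StrictMonoOn (liCoeffCharRe χ) (Set.Icc 1 48) := by
  have step : ∀ n, 1 ≤ n → n + 1 ≤ 48 → liCoeffCharRe χ n < liCoeffCharRe χ (n + 1) :=
    fun n h1 h2 ↦ liCoeffCharRe_lt_succ hq hq' χ hprim h1 h2
  intro a ha b hb hab
  obtain ⟨k, rfl⟩ : ∃ k, b = a + (k + 1) := ⟨b - a - 1, by omega⟩
  induction k with
  | zero => exact step a ha.1 (by have := hb.2; omega)
  | succ k ih =>
    have hb' : a + (k + 1) ∈ Set.Icc 1 48 := ⟨by omega, by have := hb.2; omega⟩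
    have h2 := step (a + (k + 1)) (by omega) (by have := hb.2; omega)
    rw [show a + (k + 1) + 1 = a + (k + 1 + 1) by omega] at h2
    exact (ih hb' (by omega)).trans h2

/-- **THE ARITHMETIC PART STAYS INSIDE `(−√n, √n)`**: `|lt_χ(n)| = |charLiOsc χ n| < √n` for every primitive
character of conductor `2 ≤ q ≤ 13` and every `1 ≤ n ≤ 48` (sup of `|lt_χ(n)|/√n` over the table: `0.83`).  RH-FREE
DATA (kernel-certified rows); no `∀ n` claim. -/
theorem abs_charLiOsc_lt_sqrt {q : ℕ} [NeZero q] (hq : 2 ≤ q) (hq' : q ≤ 13) (χ : DirichletCharacter ℂ q)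
    (hprim : χ.IsPrimitive) {n : ℕ} (hn : 1 ≤ n) (hn' : n ≤ 48) : |charLiOsc χ n| < Real.sqrt n := by
  obtain ⟨rows, hmem, hrows⟩ := exists_classRows_of_isPrimitive hq hq' χ hprim
  have hs := structOK_spec (structOK_of_mem hq' hmem) hn hn'
  exact abs_lt_sqrt_of_row (hrows.mem n hn hn').2 hs.1 hs.2.1

/-- **THE CONDUCTOR ORDERS THE LI COEFFICIENTS**: `λ_n(ζ) < Re λ_χ(n)` for every primitive character of conductor
`2 ≤ q ≤ 13` and every `1 ≤ n ≤ 48` (`λ_n(ζ) = keiperLiCoeff n`, kernel rows `LiKernel.keiperLiCoeff_mem_row`; smallest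
margin `0.0335` at `n = 1`, `χ = 3.2`).  RH-FREE DATA; no `∀ n` claim. -/
theorem keiperLiCoeff_lt_liCoeffCharRe {q : ℕ} [NeZero q] (hq : 2 ≤ q) (hq' : q ≤ 13) (χ : DirichletCharacter ℂ q)
    (hprim : χ.IsPrimitive) {n : ℕ} (hn : 1 ≤ n) (hn' : n ≤ 48) : keiperLiCoeff n < liCoeffCharRe χ n := by
  obtain ⟨rows, hmem, hrows⟩ := exists_classRows_of_isPrimitive hq hq' χ hprim
  have hs := structOK_spec (structOK_of_mem hq' hmem) hn hn'
  have hz : InRow (keiperLiCoeff n) (rowDigits n) (lamLo n) (lamHi n) := keiperLiCoeff_mem_row hn (by omega)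
  exact lt_of_rows_sep hz (hrows.mem n hn hn').1 hs.2.2.1

end Summit.RiemannHypothesis.RiemannHypothesis.Theorems.LiDirichletKernel
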